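import Summits.BirchSwinnertonDyer.Rank1Residual.X11b.BDPRouteErratumData
import Literature.NumberTheory.EllipticCurves.UnrIntegersUnits
import HarnessLib

/-!
# Route `ErratumRoadFive` (rung K2a), crux `IMCDivAtErratumDataAll` (item stmt-BirchSwinnertonDyer-19270, H3♭):
# the UNIT-VALUE SHORTCUT — at an erratum datum of a semistable pair where the printed BDP value at 𝟙 is a `p`-adic
# UNIT, the divisibility conjunct of H3♭ is TRIVIAL (`(Q) = ⊤`), so H3♭ AT THAT DATUM follows from print alone
# (cell `bsd-stepL`, seat `bsd-stepL-imc-p1` g5; `--supports stmt-BirchSwinnertonDyer-19270`, helper; Theses-free)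

THEOREMS ONLY (no definition, no named fact, no `sorry`); nothing about the anticyclotomic main conjecture or about BSD
is asserted; the printed input (Castella, Math. Ann. 2013 ∕ arXiv:1704.06608 Thms. 3.1–3.2 at squarefree level,
`thm32_exists_isBDPLFunction_valueAtOne`) is a HYPOTHESIS (`h32`); the unit condition is a HYPOTHESIS on the datum.

THE POINT (planner g25's registered rung `stub_rung_imcDivErratum_5835a1` of the 19270 skeleton, technique line:
«Castella JIMJ18 Thm. 2.11 supplies the integral ♭-frame at `p ∥ N` (printed); at a datum where the BDP value is a
5-adic UNIT the series `Q` is a unit of `𝓞_{ℂ₅}⟦T⟧`, `(Q) = ⊤`, and the divisibility conjunct is TRIVIAL»). Made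
precise and kernel-checked here, at the SHAPE level (any `W`, `p`): the printed frame `(Ω_K, Ω_p, L)` of `h32` has
`L(𝟙) = [T⁰]L = u·((1 − a_p p⁻¹)·log_ω P)²` with `u ∈ R₀ˣ` (`UnrSeries.eq_constantCoeff_of_hasValueAt_zero`); if
`‖(1 − a_p p⁻¹)·log_ω P‖ = 1` then `[T⁰]L ∈ R₀ˣ` (`unrIntegers.isUnit_iff_norm_eq_one`, lit-cw), so `L ∈ R₀⟦T⟧ˣ`
(`PowerSeries.isUnit_iff_constantCoeff`), so `Q := L` read in `𝓞_{ℂ_p}⟦T⟧` is a unit and EVERY ideal is `≤ (Q)` — in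
particular `Ch_Λ(X_ac^∅(E[p^∞]))·𝓞_{ℂ_p}⟦T⟧`. The interpolation property and the value conjunct transport along
`R₀⟦T⟧ → 𝓞_{ℂ_p}⟦T⟧` (`R1.isBDPLFunctionInt_map`, `R1.bdpValueAtOneIntAt_map`, multr1-p1).

CAVEAT (why this does NOT close the registered rung as typed): `P2.IMCDivIntCoreFrameAtErratumData W p` quantifies over
ALL erratum data of the pair — every erratum field `K` (infinitely many), every Manin-good parametrisation, every
Heegner point. The value `log_ω(y_K)` depends on `K`: `ord_p log_ω(y_K) = 1 + ord_p[E(K):ℤy_K]₍ₚ₎`-type terms, and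
`p ∣ #Ш(E^{d_K})` happens for some `K`; there the value is NOT a unit and the divisibility is the genuine IMC content.
So the shortcut certifies H3♭ DATUM BY DATUM (§1–§2), and the ∀-data statement only under the (unrealistic) hypothesis
that every datum is a unit datum (§3, recorded for completeness). A certifiable BC5 rung for 19270 therefore fixes the
erratum field: «H3♭ at (5835a1, 5) for erratum fields of discriminant d₀» ⟸ `h32` + ONE certified 5-adic computation
of `log_ω(y_{K₀})` — the per-datum rung and the per-datum T3 witness chain are the seat's next files.

* §1 `P2.exists_unitFrame_of_thm32_of_unitValue` — the printed frame is a UNIT frame at a unit datum.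
* §2 `P2.imcDivIntFrameAtDatum_of_thm32_of_unitValue` ∕ `P2.imcDivIntCoreFrameAtDatum_of_thm32_of_unitValue` — the
  with-value ∕ core conclusion of H3♭ AT THE DATUM (the exact `∃`-body of `P2.IMCDivIntFrameAtErratumData` ∕
  `P2.IMCDivIntCoreFrameAtErratumData`).
* §3 `P2.imcDivIntFrameAtErratumData_of_thm32_of_forall_unitValue` (+ core) — the ∀-data shapes under the ∀-data unit
  hypothesis.

References (locators only): [cite: Castella2018, Thm. 3.1, display (3.2), Thm. 3.2 (arXiv:1704.06608 p. 9)]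
[cite: Castella2018Erratum, (2.4), Thm. 1.1 (pp. 1, 4)] [cite: Castella2018Exceptional, Thms. 2.10–2.11].
-/

noncomputable section

open scoped Classical

open WeierstrassCurve NumberField IsDedekindDomain Field PowerSeries
open Literature.NumberTheory.EllipticCurves Literature.NumberTheory.EllipticCurves.GreenbergSelmer
open Literature.NumberTheory.EllipticCurves.ModularForms
open Literature.NumberTheory.EllipticCurves.Rank1Residual
open Literature.NumberTheory.EllipticCurves.Rank1Residual.Typed
open Literature.NumberTheory.EllipticCurves.Castella2018
open Literature.NumberTheory.GaloisRepresentations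
open Literature.NumberTheory.GaloisCohomology
open Summit.BirchSwinnertonDyer.Rank1Residual.X11b.AcSelmer
open Summit.BirchSwinnertonDyer.Rank1Residual.X11b.Halves

namespace Summit.BirchSwinnertonDyer.Rank1Residual.X11b

variable {W : WeierstrassCurve ℚ} [W.IsElliptic] [W.IsGloballyMinimal] {p : ℕ} [Fact p.Prime]
  {K : Type} [Field K] [NumberField K]

/-! ### §1 The printed frame is a unit frame at a unit datum -/

/-- **The printed ♭-frame is a UNIT of `𝓞_{ℂ_p}⟦T⟧` at a unit datum.** For a SEMISTABLE pair `(E, p)` with the erratum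
hypotheses (`p ≥ 5`, multiplicative `p`, `E[p]` irreducible), an erratum field `K` for `q ≠ p`, a parametrisation
datum `Dt` of level `N_E` with `p ∤ c`, a Heegner datum `H`, a point `P ∈ E(K)` reading `heegnerPointComplex Dt H`
along `w₀`, an anticyclotomic `κ` with generator `γ`, `ι' : ℂ_p ≃ ℂ` and the compatible `e : K → ℚ_p`: Castella's
printed Thms. 3.1–3.2 (`h32`) give a frame `(Ω_K ≠ 0, Ω_p ∈ R₀ˣ, L ∈ R₀⟦T⟧)` with the interpolation property and
`L(𝟙) = u·((1 − a_p p⁻¹)·log_ω P)²`; if `‖(1 − a_p p⁻¹)·log_ω P‖ = 1` then `Q := L` read in `𝓞_{ℂ_p}⟦T⟧` is a UNIT, with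
the interpolation property and the value conjunct there. CONDITIONAL on `h32` and the unit hypothesis; nothing booked.
[cite: Castella2018, Thm. 3.1, display (3.2) and Thm. 3.2 (arXiv:1704.06608 p. 9)] -/
theorem P2.exists_unitFrame_of_thm32_of_unitValue
    (h32 : thm32_exists_isBDPLFunction_valueAtOne)
    [NeZero (W.conductorNorm ℤ)] {q : ℕ} [Fact q.Prime]
    (Dt : ModularParametrizationData W (W.conductorNorm ℤ))
    (H : HeegnerDatum (W.conductorNorm ℤ) (NumberField.discr K)) (w₀ : InfinitePlace K)
    {P : (W.baseChange K).toAffine.Point} (hE : ErratumHypotheses W p) (hss : Semistable W)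
    (hqp : q ≠ p) (hK : IsErratumField W K q)
    (hP : WeierstrassCurve.Affine.Point.map w₀.embedding.toRatAlgHom P = heegnerPointComplex Dt H)
    (hc : ¬ (p : ℤ) ∣ Dt.c)
    (κ : ZpExtension K p) (hκ : κ.IsAnticyclotomic) (γ : Field.absoluteGaloisGroup K)
    [Fact (κ.IsTopGenerator γ)] (ι' : PadicAlgCl p ≃+* ℂ) {e : K →+* ℚ_[p]}
    (he : ∀ k : 𝓞 K, k ∈ (primeOfEmbeddingDatum p ι' w₀.embedding).asIdeal ↔ ‖e (k : K)‖ < 1)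
    (hunit : ‖((1 : ℚ_[p]) - (W.LFunction p : ℚ_[p]) * (p : ℚ_[p])⁻¹) * logOmega W p e P‖ = 1) :
    ∃ (ΩK : ℂ) (Ωp : ℂ_[p]) (Q : PowerSeries 𝓞_ℂ_[p]), ΩK ≠ 0 ∧ ‖Ωp‖ = 1 ∧
      R1.IsBDPLFunctionInt p ι' (primeOfEmbeddingDatum p ι' w₀.embedding) κ γ Dt.f ΩK Ωp Q ∧
      R1.BDPValueAtOneIntAt W p e P Q (W.LFunction p) ∧ IsUnit Q := by
  obtain ⟨ΩK, Ωp, L, hΩ, hL, hval⟩ :=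
    R1.exists_frame_bdpValueAtOneOnTreeAt_of_thm32 h32 ι' Dt H hE hss hqp hK hc w₀ hP κ hκ γ he
  obtain ⟨u, hu⟩ := hval
  -- the value at 𝟙 is the constant term, of norm one
  have hc0 := UnrSeries.eq_constantCoeff_of_hasValueAt_zero hu
  have hnorm : ‖((PowerSeries.constantCoeff L : unrIntegers p) : ℂ_[p])‖ = 1 := by
    rw [← hc0, norm_mul, norm_pow, norm_coe_units_unrIntegers, one_mul, norm_algebraMap', hunit, one_pow]
  -- hence `L` is a unit of `R₀⟦T⟧`, and so is its image `Q` in `𝓞_{ℂ_p}⟦T⟧`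
  have hLu : IsUnit L :=
    PowerSeries.isUnit_iff_constantCoeff.mpr ((unrIntegers.isUnit_iff_norm_eq_one _).mpr hnorm)
  exact ⟨ΩK, ((Ωp : unrIntegers p) : ℂ_[p]), PowerSeries.map (R1.unrToCpInt p) L, hΩ,
    norm_coe_units_unrIntegers p Ωp, R1.isBDPLFunctionInt_map hL, R1.bdpValueAtOneIntAt_map ⟨u, hu⟩,
    hLu.map (PowerSeries.map (R1.unrToCpInt p))⟩

/-! ### §2 H3♭ AT THE DATUM from print at a unit datum -/

/-- **H3♭ WITH VALUE, AT A UNIT DATUM, from print alone**: the `∃`-body of `P2.IMCDivIntFrameAtErratumData W p` at the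
datum — a frame with Castella's interpolation property, the value conjunct, and the divisibility
`Ch_Λ(X_ac^∅(E[p^∞]))·𝓞_{ℂ_p}⟦T⟧ ⊆ (Q)` — the last being TRIVIAL because `(Q) = ⊤` (§1). Semistable pair; unit hypothesis
on the datum. CONDITIONAL on `h32`; nothing booked; at a non-unit datum nothing is claimed.
[cite: Castella2018, Thms. 3.1–3.2 (arXiv:1704.06608 p. 9)] [cite: Castella2018Erratum, (2.4) (p. 4)] -/
theorem P2.imcDivIntFrameAtDatum_of_thm32_of_unitValue
    (h32 : thm32_exists_isBDPLFunction_valueAtOne)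
    [NeZero (W.conductorNorm ℤ)] {q : ℕ} [Fact q.Prime]
    (Dt : ModularParametrizationData W (W.conductorNorm ℤ))
    (H : HeegnerDatum (W.conductorNorm ℤ) (NumberField.discr K)) (w₀ : InfinitePlace K)
    {P : (W.baseChange K).toAffine.Point} (hE : ErratumHypotheses W p) (hss : Semistable W)
    (hqp : q ≠ p) (hK : IsErratumField W K q)
    (hP : WeierstrassCurve.Affine.Point.map w₀.embedding.toRatAlgHom P = heegnerPointComplex Dt H)
    (hc : ¬ (p : ℤ) ∣ Dt.c)
    (κ : ZpExtension K p) (hκ : κ.IsAnticyclotomic) (γ : Field.absoluteGaloisGroup K)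
    [Fact (κ.IsTopGenerator γ)] (ι' : PadicAlgCl p ≃+* ℂ) {e : K →+* ℚ_[p]}
    (he : ∀ k : 𝓞 K, k ∈ (primeOfEmbeddingDatum p ι' w₀.embedding).asIdeal ↔ ‖e (k : K)‖ < 1)
    (hunit : ‖((1 : ℚ_[p]) - (W.LFunction p : ℚ_[p]) * (p : ℚ_[p])⁻¹) * logOmega W p e P‖ = 1) :
    ∃ (ΩK : ℂ) (Ωp : ℂ_[p]) (Q : PowerSeries 𝓞_ℂ_[p]), ΩK ≠ 0 ∧ ‖Ωp‖ = 1 ∧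
      R1.IsBDPLFunctionInt p ι' (primeOfEmbeddingDatum p ι' w₀.embedding) κ γ Dt.f ΩK Ωp Q ∧
      R1.BDPValueAtOneIntAt W p e P Q (W.LFunction p) ∧
      (XAc.charIdeal (W.baseChange K) p κ (primeOfEmbeddingDatum p ι' w₀.embedding) ∅ γ).map
          (PowerSeries.map (R1.toCpInt p)) ≤ Ideal.span {Q} := by
  obtain ⟨ΩK, Ωp, Q, hΩ, hΩp, hQ, hval, hQu⟩ :=
    P2.exists_unitFrame_of_thm32_of_unitValue h32 Dt H w₀ hE hss hqp hK hP hc κ hκ γ ι' he hunit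
  exact ⟨ΩK, Ωp, Q, hΩ, hΩp, hQ, hval, by rw [Ideal.span_singleton_eq_top.mpr hQu]; exact le_top⟩

/-- **H3♭ CORE (no value conjunct), AT A UNIT DATUM, from print alone**: the `∃`-body of
`P2.IMCDivIntCoreFrameAtErratumData W p` at the datum. CONDITIONAL on `h32`; nothing booked.
[cite: Castella2018, Thms. 3.1–3.2 (arXiv:1704.06608 p. 9)] [cite: Castella2018Erratum, (2.4) (p. 4)] -/
theorem P2.imcDivIntCoreFrameAtDatum_of_thm32_of_unitValue
    (h32 : thm32_exists_isBDPLFunction_valueAtOne)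
    [NeZero (W.conductorNorm ℤ)] {q : ℕ} [Fact q.Prime]
    (Dt : ModularParametrizationData W (W.conductorNorm ℤ))
    (H : HeegnerDatum (W.conductorNorm ℤ) (NumberField.discr K)) (w₀ : InfinitePlace K)
    {P : (W.baseChange K).toAffine.Point} (hE : ErratumHypotheses W p) (hss : Semistable W)
    (hqp : q ≠ p) (hK : IsErratumField W K q)
    (hP : WeierstrassCurve.Affine.Point.map w₀.embedding.toRatAlgHom P = heegnerPointComplex Dt H)
    (hc : ¬ (p : ℤ) ∣ Dt.c)
    (κ : ZpExtension K p) (hκ : κ.IsAnticyclotomic) (γ : Field.absoluteGaloisGroup K)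
    [Fact (κ.IsTopGenerator γ)] (ι' : PadicAlgCl p ≃+* ℂ) {e : K →+* ℚ_[p]}
    (he : ∀ k : 𝓞 K, k ∈ (primeOfEmbeddingDatum p ι' w₀.embedding).asIdeal ↔ ‖e (k : K)‖ < 1)
    (hunit : ‖((1 : ℚ_[p]) - (W.LFunction p : ℚ_[p]) * (p : ℚ_[p])⁻¹) * logOmega W p e P‖ = 1) :
    ∃ (ΩK : ℂ) (Ωp : ℂ_[p]) (Q : PowerSeries 𝓞_ℂ_[p]), ΩK ≠ 0 ∧ ‖Ωp‖ = 1 ∧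
      R1.IsBDPLFunctionInt p ι' (primeOfEmbeddingDatum p ι' w₀.embedding) κ γ Dt.f ΩK Ωp Q ∧
      (XAc.charIdeal (W.baseChange K) p κ (primeOfEmbeddingDatum p ι' w₀.embedding) ∅ γ).map
          (PowerSeries.map (R1.toCpInt p)) ≤ Ideal.span {Q} := by
  obtain ⟨ΩK, Ωp, Q, hΩ, hΩp, hQ, -, hdvd⟩ :=
    P2.imcDivIntFrameAtDatum_of_thm32_of_unitValue h32 Dt H w₀ hE hss hqp hK hP hc κ hκ γ ι' he hunit
  exact ⟨ΩK, Ωp, Q, hΩ, hΩp, hQ, hdvd⟩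

/-! ### §3 The ∀-data shapes under the ∀-data unit hypothesis (completeness only) -/

/-- **If EVERY erratum datum of a semistable pair is a unit datum, H3♭ (with value) holds at the pair from print.**
The hypothesis `hunits` has the binders of `P2.IMCDivIntFrameAtErratumData W p` VERBATIM and concludes the unit
condition; it is UNREALISTIC class-wide (see the module docstring: the value is not a unit at erratum fields with
`p ∣ #Ш(E^{d_K})`), and is recorded only to make the logical relation to the registered ∀-data rung explicit.
CONDITIONAL on `h32` and `hunits`; nothing booked. [cite: Castella2018, Thms. 3.1–3.2] [cite: Castella2018Erratum, (2.4)] -/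
theorem P2.imcDivIntFrameAtErratumData_of_thm32_of_forall_unitValue
    (h32 : thm32_exists_isBDPLFunction_valueAtOne) (hss : Semistable W)
    (hunits : ∀ [NeZero (W.conductorNorm ℤ)] (q : ℕ) [Fact q.Prime] (K : Type) [Field K] [NumberField K]
      (Dt : ModularParametrizationData W (W.conductorNorm ℤ))
      (H : HeegnerDatum (W.conductorNorm ℤ) (NumberField.discr K)) (w₀ : InfinitePlace K)
      (P : (W.baseChange K).toAffine.Point), ErratumHypotheses W p → W.analyticRank = 1 →
      q ≠ p → Mult W q → ¬ W.HasSplitMultiplicativeReductionAtPrime q →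
      ¬ p ∣ padicValInt q W.minimalDiscriminantInt → IsErratumField W K q →
      Cas20Standing K p (W.conductorNorm ℤ / p) →
      WeierstrassCurve.Affine.Point.map w₀.embedding.toRatAlgHom P = heegnerPointComplex Dt H →
      ¬ (p : ℤ) ∣ Dt.c → ¬ IsOfFinAddOrder P →
      ∀ (κ : ZpExtension K p), κ.IsAnticyclotomic →
        ∀ (γ : Field.absoluteGaloisGroup K) [Fact (κ.IsTopGenerator γ)] (ι' : PadicAlgCl p ≃+* ℂ)
          (e : K →+* ℚ_[p]),
          (∀ k : 𝓞 K, k ∈ (primeOfEmbeddingDatum p ι' w₀.embedding).asIdeal ↔ ‖e (k : K)‖ < 1) →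
          ‖((1 : ℚ_[p]) - (W.LFunction p : ℚ_[p]) * (p : ℚ_[p])⁻¹) * logOmega W p e P‖ = 1) :
    P2.IMCDivIntFrameAtErratumData W p := by
  intro _ q _ K _ _ Dt H w₀ P hE hr hqp hmq hns hvq hK hCas hP hc hinf κ hκ γ _ ι' e he
  exact P2.imcDivIntFrameAtDatum_of_thm32_of_unitValue h32 Dt H w₀ hE hss hqp hK hP hc κ hκ γ ι' he
    (hunits q K Dt H w₀ P hE hr hqp hmq hns hvq hK hCas hP hc hinf κ hκ γ ι' e he)

/-- **… and the CORE shape** (`P2.IMCDivIntCoreFrameAtErratumData W p`, the currency of crux 19270 and of its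
registered ∀-data rung) under the same ∀-data unit hypothesis. CONDITIONAL; nothing booked.
[cite: Castella2018, Thms. 3.1–3.2] [cite: Castella2018Erratum, (2.4)] -/
theorem P2.imcDivIntCoreFrameAtErratumData_of_thm32_of_forall_unitValue
    (h32 : thm32_exists_isBDPLFunction_valueAtOne) (hss : Semistable W)
    (hunits : ∀ [NeZero (W.conductorNorm ℤ)] (q : ℕ) [Fact q.Prime] (K : Type) [Field K] [NumberField K]
      (Dt : ModularParametrizationData W (W.conductorNorm ℤ))
      (H : HeegnerDatum (W.conductorNorm ℤ) (NumberField.discr K)) (w₀ : InfinitePlace K)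
      (P : (W.baseChange K).toAffine.Point), ErratumHypotheses W p → W.analyticRank = 1 →
      q ≠ p → Mult W q → ¬ W.HasSplitMultiplicativeReductionAtPrime q →
      ¬ p ∣ padicValInt q W.minimalDiscriminantInt → IsErratumField W K q →
      Cas20Standing K p (W.conductorNorm ℤ / p) →
      WeierstrassCurve.Affine.Point.map w₀.embedding.toRatAlgHom P = heegnerPointComplex Dt H →
      ¬ (p : ℤ) ∣ Dt.c → ¬ IsOfFinAddOrder P →
      ∀ (κ : ZpExtension K p), κ.IsAnticyclotomic →
        ∀ (γ : Field.absoluteGaloisGroup K) [Fact (κ.IsTopGenerator γ)] (ι' : PadicAlgCl p ≃+* ℂ)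
          (e : K →+* ℚ_[p]),
          (∀ k : 𝓞 K, k ∈ (primeOfEmbeddingDatum p ι' w₀.embedding).asIdeal ↔ ‖e (k : K)‖ < 1) →
          ‖((1 : ℚ_[p]) - (W.LFunction p : ℚ_[p]) * (p : ℚ_[p])⁻¹) * logOmega W p e P‖ = 1) :
    P2.IMCDivIntCoreFrameAtErratumData W p :=
  P2.imcDivIntCoreFrameAtErratumData_of_imcDivIntFrame
    (P2.imcDivIntFrameAtErratumData_of_thm32_of_forall_unitValue h32 hss hunits)

end Summit.BirchSwinnertonDyer.Rank1Residual.X11b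

end
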